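import Mathlib
import HarnessLib
import Summits.Ventures.LatticeQCDFlow.Exactness.NCMCGeneralSpaceWilsonHeatBathRestart
import Summits.Ventures.LatticeQCDFlow.Exactness.CabibboMarinariLatticeErgodic

/-!
# The engine's composite sweeps as level samplers: heat bath followed by exact updates, and the SU(N) Cabibbo–Marinari sweep — `ΔF̂_n → ΔF` a.s. for correlated starts

HONEST FRAMING: exact (Metropolis-corrected) sampling algorithms for lattice gauge theory;
figures of merit are autocorrelation/cost numbers at stated couplings and volumes; no
continuum-physics claim.

Venture `LatticeQCDFlow` (cell pub-lqcd), topic `Exactness`; FANOUT row 13 (`eng-snf`, GEN-16).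
NEW WORK of the cell, not a published result; no definition is introduced; nothing is cited as a
fact.  Continuation of `NCMCGeneralSpaceWilsonHeatBathRestart.lean` (the single-link heat-bath
scan as level sampler).  The engine's level sampler between launches is in fact
`composite_sweep` = ONE heat-bath sweep then `n_or` over-relaxation sweeps (`1HB + 4OR`), and for
`SU(3)` the "heat bath" is the Cabibbo–Marinari pseudo-heat-bath over the `SU(2)` subgroups
(`latflow.core` `lc_sweep`).  Both are covered here by assembling row 9's theorems:
`HeatBathSweepErgodic.heatBathSweep_minorised`, `CabibboMarinariLatticeErgodic.latSweep_minorised` /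
`latHit_invariant`, with GEN-16's measure-form criterion.

## Content

* §1 `measure_le_comp` — a minorisation `m ≤ K(z, ·)` survives post-composition with ANY Markov
  kernel `η`: `η ∘ₘ m ≤ (η ∘ₖ K)(z, ·)`; **`CrooksPair.tendsto_jarzynskiEstimate_ae_restartChain_comp`**
  — with `η` `ν₀`-invariant (over-relaxation sweeps, measure-preserving reflections, further exact
  hits), the restart chain driven by `η ∘ₖ K` is ergodic and `ΔF̂_n → ΔF` a.s.
* §2 **`CrooksPair.tendsto_jarzynskiEstimate_ae_wilsonHeatBathCompRestart`** — torus Wilson theory,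
  compact `G`: heat-bath link sweep followed by any `wilsonWeight`-invariant Markov kernel.
* §3 `latSweep_invariant_withDensity` (the CM sweep leaves the unnormalised weight `p · ⊗Haar`
  invariant); **`CrooksPair.tendsto_jarzynskiEstimate_ae_wilsonCMSweepRestart`** — torus Wilson
  theory with gauge group `SU(N)` (`Matrix.specialUnitaryGroup n ℂ`, `n` nonempty, any continuous
  `ρ`, `β`, `d`, `L`): the Cabibbo–Marinari sweep (all coordinate pairs, lexicographic or reversed;
  every edge visited) as level sampler ⇒ along the equilibrium restart chain of forward evolutions of
  ANY Crooks pair out of `wilsonWeight ρ β`, `ΔF̂_n → ΔF` almost surely.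

NOT CLAIMED: rates; HMC as level sampler; the CM sweep followed by over-relaxation (combine §1 with
§3 exactly as §2 does with the heat bath — not restated).
-/

namespace Summit.Ventures.LatticeQCDFlow.Exactness.GeneralNCMC

open MeasureTheory ProbabilityTheory Set Filter Finset
open scoped ENNReal Topology

/-! ## §1 Minorisation survives an exact post-update -/

section Comp

variable {Ω : Type*} [MeasurableSpace Ω]

/-- `m ≤ K(z, ·)` for all `z` gives `η ∘ₘ m ≤ (η ∘ₖ K)(z, ·)` for all `z`. -/
theorem measure_le_comp (K η : Kernel Ω Ω) {m : Measure Ω} (hmin : ∀ z, m ≤ K z) (z : Ω) :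
    m.bind η ≤ (η ∘ₖ K) z := by
  refine Measure.le_iff.2 fun t ht => ?_
  rw [Kernel.comp_apply' _ _ _ ht, Measure.bind_apply ht (Kernel.aemeasurable _)]
  exact lintegral_mono' (hmin z) le_rfl

end Comp

namespace CrooksPair

variable {Ω E : Type*} [MeasurableSpace Ω] [MeasurableSpace E]
variable {ν₀ ν₁ : Measure Ω} {κF κR : Kernel Ω E} {s e : E → Ω} {W : E → ℝ}

/-- **Heat bath then exact updates.**  If the level sampler is `η ∘ₖ K` with `K` minorised by a
non-zero finite measure and `η` any `ν₀`-invariant Markov kernel, the equilibrium restart chain is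
ergodic and `ΔF̂_n → ΔF` almost surely. -/
theorem tendsto_jarzynskiEstimate_ae_restartChain_comp (K η : Kernel Ω Ω) [IsMarkovKernel K]
    [IsMarkovKernel η] [IsFiniteMeasure ν₀] [IsFiniteMeasure ν₁] [IsMarkovKernel κF]
    [IsMarkovKernel κR] (h0 : ν₀ univ ≠ 0) (hK : Kernel.Invariant K ν₀) (hη : Kernel.Invariant η ν₀)
    (h : CrooksPair ν₀ ν₁ κF κR s e W) {ΔF : ℝ}
    (hΔF : Real.exp (-ΔF) = ((ν₀ univ)⁻¹ * ν₁ univ).toReal) {m : Measure Ω} [IsFiniteMeasure m]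
    (hm0 : m univ ≠ 0) (hmin : ∀ z, m ≤ K z) :
    haveI := isProbabilityMeasure_fwdPathLaw ν₀ h0 κF
    ∀ᵐ x ∂(Kernel.trajMeasure (X := fun _ : ℕ => E) (fwdPathLaw ν₀ κF)
        (fun n : ℕ => ((κF ∘ₖ (η ∘ₖ K)).comap s h.measurable_s).comap
          (fun hh : (j : ↥(Finset.Iic n)) → E => hh ⟨n, Finset.mem_Iic.2 le_rfl⟩)
          (measurable_pi_apply _))),
      Tendsto (fun n : ℕ => jarzynskiEstimate (fun ε => Real.exp (-W ε)) (fun i : Fin n => x i))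
        atTop (𝓝 ΔF) := by
  haveI : IsFiniteMeasure (m.bind η) := inferInstance
  exact h.tendsto_jarzynskiEstimate_ae_restartChain_of_measure_le (η ∘ₖ K) h0 (hη.comp hK) hΔF
    (m := m.bind η) (by rw [bind_apply_univ_of_markov]; exact hm0) (measure_le_comp K η hmin)

end CrooksPair

/-! ## §2 Torus Wilson theory: the heat-bath link sweep followed by exact updates -/

section WilsonComp

open Literature.MathematicalPhysics.QuantumFieldTheory

variable {d L N : ℕ} {G : Type*} [Group G] [TopologicalSpace G] [IsTopologicalGroup G]
  (ρ : G →* Matrix (Fin N) (Fin N) ℂ) [CompactSpace G] [MeasurableSpace G] [BorelSpace G]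
  [SecondCountableTopology G]

/-- **`1HB + n_or OR` as level sampler, compact `G`.**  Torus Wilson theory, heat-bath link scan
over a list visiting every edge, followed by ANY Markov kernel `η` leaving `wilsonWeight ρ β`
invariant: for every Crooks pair out of `wilsonWeight ρ β`, `ΔF̂_n → ΔF` almost surely along the
equilibrium restart chain. -/
theorem CrooksPair.tendsto_jarzynskiEstimate_ae_wilsonHeatBathCompRestart [NeZero L]
    (hρ : Continuous ρ) (β : ℝ) {l : List (Edge d L)} (hl : ∀ ed, ed ∈ l)
    (η : Kernel (GaugeConfig d L G) (GaugeConfig d L G)) [IsMarkovKernel η]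
    (hη : Kernel.Invariant η (wilsonWeight (d := d) (L := L) ρ β)) {E : Type*} [MeasurableSpace E]
    {ν₁ : Measure (GaugeConfig d L G)} [IsFiniteMeasure ν₁]
    {κF κR : Kernel (GaugeConfig d L G) E} [IsMarkovKernel κF] [IsMarkovKernel κR]
    {s e : E → GaugeConfig d L G} {W : E → ℝ}
    (h : CrooksPair (wilsonWeight (d := d) (L := L) ρ β) ν₁ κF κR s e W) {ΔF : ℝ}
    (hΔF : Real.exp (-ΔF) = (((wilsonWeight (d := d) (L := L) ρ β) univ)⁻¹ * ν₁ univ).toReal) :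
    ∃ (_ : IsMarkovKernel (cycle (l.map (siteHeatBath (fun _ : Edge d L => haarProbability G)
        (gibbsDensity fun U : GaugeConfig d L G => β * wilsonAction ρ U)))))
      (_ : IsProbabilityMeasure (fwdPathLaw (wilsonWeight (d := d) (L := L) ρ β) κF)),
    ∀ᵐ x ∂(Kernel.trajMeasure (X := fun _ : ℕ => E) (fwdPathLaw (wilsonWeight (d := d) (L := L) ρ β) κF)
        (fun n : ℕ => ((κF ∘ₖ (η ∘ₖ cycle (l.map (siteHeatBath (fun _ : Edge d L => haarProbability G)
          (gibbsDensity fun U : GaugeConfig d L G => β * wilsonAction ρ U))))).comap s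
            h.measurable_s).comap
          (fun hh : (j : ↥(Finset.Iic n)) → E => hh ⟨n, Finset.mem_Iic.2 le_rfl⟩)
          (measurable_pi_apply _))),
      Tendsto (fun n : ℕ => jarzynskiEstimate (fun ε => Real.exp (-W ε)) (fun i : Fin n => x i))
        atTop (𝓝 ΔF) := by
  have hS : Continuous fun U : GaugeConfig d L G => β * wilsonAction ρ U :=
    continuous_smul_wilsonAction ρ hρ β
  haveI : Nonempty (GaugeConfig d L G) := ⟨fun _ => 1⟩
  obtain ⟨ωa, -, hmin⟩ := isCompact_univ.exists_isMinOn Set.univ_nonempty hS.continuousOn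
  obtain ⟨ωb, -, hmax⟩ := isCompact_univ.exists_isMaxOn Set.univ_nonempty hS.continuousOn
  have hωa : ∀ U, β * wilsonAction ρ ωa ≤ β * wilsonAction ρ U :=
    fun U => (isMinOn_iff.1 hmin) U (Set.mem_univ U)
  have hωb : ∀ U, β * wilsonAction ρ U ≤ β * wilsonAction ρ ωb :=
    fun U => (isMaxOn_iff.1 hmax) U (Set.mem_univ U)
  have hm0 : ENNReal.ofReal (Real.exp (-(β * wilsonAction ρ ωb))) ≠ 0 := by
    rw [Ne, ENNReal.ofReal_eq_zero, not_le]; exact Real.exp_pos _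
  have hM0 : ENNReal.ofReal (Real.exp (-(β * wilsonAction ρ ωa))) ≠ 0 := by
    rw [Ne, ENNReal.ofReal_eq_zero, not_le]; exact Real.exp_pos _
  have hp := measurable_gibbsDensity hS
  have hmp := fun ω => (gibbsDensity_bounds hωa hωb ω).1
  have hpM := fun ω => (gibbsDensity_bounds hωa hωb ω).2
  haveI hMk := isMarkovKernel_heatBathSweep (μ := fun _ : Edge d L => haarProbability G) hp hm0
    ENNReal.ofReal_ne_top hmp hpM l
  haveI hfin : IsFiniteMeasure (wilsonWeight (d := d) (L := L) ρ β) := by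
    rw [wilsonWeight_eq_pi_withDensity]
    exact isFiniteMeasure_pi_withDensity (μ := fun _ : Edge d L => haarProbability G)
      ENNReal.ofReal_ne_top hpM
  have h0 : wilsonWeight (d := d) (L := L) ρ β univ ≠ 0 := by
    rw [wilsonWeight_eq_pi_withDensity]
    exact pi_withDensity_univ_ne_zero hm0 hmp
  haveI := isProbabilityMeasure_fwdPathLaw _ h0 κF
  refine ⟨hMk, inferInstance, ?_⟩
  -- invariance and minorisation of the heat-bath sweep for the Wilson weight
  have hp_top : ∀ ω, gibbsDensity (fun U : GaugeConfig d L G => β * wilsonAction ρ U) ω ≠ ∞ :=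
    fun ω => ne_top_of_le_ne_top ENNReal.ofReal_ne_top (hpM ω)
  have hZ : ∀ i ω, siteNorm (fun _ : Edge d L => haarProbability G)
      (gibbsDensity fun U : GaugeConfig d L G => β * wilsonAction ρ U) i ω ≠ 0 := fun i ω =>
    (lt_of_lt_of_le (pos_iff_ne_zero.2 hm0) (le_siteNorm hmp i ω)).ne'
  have hZtop : ∀ i ω, siteNorm (fun _ : Edge d L => haarProbability G)
      (gibbsDensity fun U : GaugeConfig d L G => β * wilsonAction ρ U) i ω ≠ ∞ := fun i ω =>
    ne_top_of_le_ne_top ENNReal.ofReal_ne_top (siteNorm_le hpM i ω)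
  have hK : Kernel.Invariant (cycle (l.map (siteHeatBath (fun _ : Edge d L => haarProbability G)
      (gibbsDensity fun U : GaugeConfig d L G => β * wilsonAction ρ U))))
      (wilsonWeight (d := d) (L := L) ρ β) := by
    rw [wilsonWeight_eq_pi_withDensity]
    exact heatBathSweep_invariant hp hp_top hZ hZtop l
  set c : ℝ≥0∞ := (ENNReal.ofReal (Real.exp (-(β * wilsonAction ρ ωb))) *
    (ENNReal.ofReal (Real.exp (-(β * wilsonAction ρ ωa))))⁻¹) ^ l.length with hc
  have hc_top : c ≠ ∞ :=
    ENNReal.pow_ne_top (ENNReal.mul_ne_top ENNReal.ofReal_ne_top (ENNReal.inv_ne_top.2 hM0))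
  have hc0 : c ≠ 0 :=
    pow_ne_zero _ (mul_ne_zero hm0 (ENNReal.inv_ne_zero.2 ENNReal.ofReal_ne_top))
  haveI : IsFiniteMeasure (c • Measure.pi fun _ : Edge d L => haarProbability G) :=
    Measure.smul_finite _ hc_top
  have hmu : (c • Measure.pi fun _ : Edge d L => haarProbability G) univ ≠ 0 := by
    rw [Measure.smul_apply, smul_eq_mul, measure_univ, mul_one]
    exact hc0
  exact h.tendsto_jarzynskiEstimate_ae_restartChain_comp _ η h0 hK hη hΔF hmu
    (heatBathSweep_minorised hp hm0 ENNReal.ofReal_ne_top hmp hpM hl)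

end WilsonComp

/-! ## §3 Torus Wilson theory with gauge group `SU(N)`: the Cabibbo–Marinari sweep -/

section CM

open Literature.MathematicalPhysics.QuantumFieldTheory

variable {n : Type*} [Fintype n] [DecidableEq n] [Nonempty n] [LinearOrder n]
variable {ι : Type*} [Fintype ι] [DecidableEq ι] {m : Type*} [Fintype m] [DecidableEq m]

omit [Nonempty n] [LinearOrder n] in
/-- **The Cabibbo–Marinari sweep leaves the unnormalised weight `p · ⊗Haar` invariant** (row 9's
`latHit_invariant`, cycled over frames and links). -/
theorem latSweep_invariant_withDensity {p : Cfg ι n → ℝ≥0∞} {mlo Mhi : ℝ≥0∞} (hp : Measurable p)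
    (hm0 : mlo ≠ 0) (hMtop : Mhi ≠ ∞) (hmp : ∀ ω, mlo ≤ p ω) (hpM : ∀ ω, p ω ≤ Mhi)
    (frames : List (n ≃ Fin 2 ⊕ m)) (links : List ι) :
    Kernel.Invariant (latSweep p frames links) ((Measure.pi (linkHaar ι n)).withDensity p) := by
  refine invariant_cycle fun κ hκ => ?_
  obtain ⟨l, -, rfl⟩ := List.mem_map.1 hκ
  refine invariant_cycle fun κ' hκ' => ?_
  obtain ⟨e, -, rfl⟩ := List.mem_map.1 hκ'
  exact latHit_invariant hp hm0 hMtop hmp hpM l e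

variable {d L N : ℕ} (ρ : Matrix.specialUnitaryGroup n ℂ →* Matrix (Fin N) (Fin N) ℂ)

/-- **THE SU(N) ENGINE INSTANCE.**  Torus Wilson theory with gauge group `SU(N)` (any continuous
`ρ`, `β`, `d`, `L ≠ 0`); level sampler = the Cabibbo–Marinari sweep (`lc_sweep`: every link, every
coordinate pair lexicographically or reversed).  For every Crooks pair out of `wilsonWeight ρ β`:
along the equilibrium restart chain of forward evolutions, `ΔF̂_n → ΔF` almost surely. -/
theorem CrooksPair.tendsto_jarzynskiEstimate_ae_wilsonCMSweepRestart [NeZero L] (hρ : Continuous ρ)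
    (β : ℝ) (frames : List (n ≃ Fin 2 ⊕ m))
    (hlex : frames.map pairOf = lexPairs (Finset.univ.sort (· ≤ ·) : List n) ∨
      frames.map pairOf = (lexPairs (Finset.univ.sort (· ≤ ·) : List n)).reverse)
    {links : List (Edge d L)} (hl : ∀ ed, ed ∈ links) {E : Type*} [MeasurableSpace E]
    {ν₁ : Measure (GaugeConfig d L (Matrix.specialUnitaryGroup n ℂ))} [IsFiniteMeasure ν₁]
    {κF κR : Kernel (GaugeConfig d L (Matrix.specialUnitaryGroup n ℂ)) E} [IsMarkovKernel κF]
    [IsMarkovKernel κR] {s e : E → GaugeConfig d L (Matrix.specialUnitaryGroup n ℂ)} {W : E → ℝ}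
    (h : CrooksPair (wilsonWeight (d := d) (L := L) ρ β) ν₁ κF κR s e W) {ΔF : ℝ}
    (hΔF : Real.exp (-ΔF) = (((wilsonWeight (d := d) (L := L) ρ β) univ)⁻¹ * ν₁ univ).toReal) :
    ∃ (_ : IsMarkovKernel (latSweep (gibbsDensity fun U : GaugeConfig d L
        (Matrix.specialUnitaryGroup n ℂ) => β * wilsonAction ρ U) frames links))
      (_ : IsProbabilityMeasure (fwdPathLaw (wilsonWeight (d := d) (L := L) ρ β) κF)),
    ∀ᵐ x ∂(Kernel.trajMeasure (X := fun _ : ℕ => E) (fwdPathLaw (wilsonWeight (d := d) (L := L) ρ β) κF)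
        (fun k : ℕ => ((κF ∘ₖ latSweep (gibbsDensity fun U : GaugeConfig d L
          (Matrix.specialUnitaryGroup n ℂ) => β * wilsonAction ρ U) frames links).comap s
            h.measurable_s).comap
          (fun hh : (j : ↥(Finset.Iic k)) → E => hh ⟨k, Finset.mem_Iic.2 le_rfl⟩)
          (measurable_pi_apply _))),
      Tendsto (fun k : ℕ => jarzynskiEstimate (fun ε => Real.exp (-W ε)) (fun i : Fin k => x i))
        atTop (𝓝 ΔF) := by
  have hS : Continuous fun U : GaugeConfig d L (Matrix.specialUnitaryGroup n ℂ) =>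
      β * wilsonAction ρ U := continuous_smul_wilsonAction ρ hρ β
  haveI : Nonempty (GaugeConfig d L (Matrix.specialUnitaryGroup n ℂ)) := ⟨fun _ => 1⟩
  obtain ⟨ωa, -, hmin⟩ := isCompact_univ.exists_isMinOn Set.univ_nonempty hS.continuousOn
  obtain ⟨ωb, -, hmax⟩ := isCompact_univ.exists_isMaxOn Set.univ_nonempty hS.continuousOn
  have hωa : ∀ U, β * wilsonAction ρ ωa ≤ β * wilsonAction ρ U :=
    fun U => (isMinOn_iff.1 hmin) U (Set.mem_univ U)
  have hωb : ∀ U, β * wilsonAction ρ U ≤ β * wilsonAction ρ ωb :=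
    fun U => (isMaxOn_iff.1 hmax) U (Set.mem_univ U)
  have hm0 : ENNReal.ofReal (Real.exp (-(β * wilsonAction ρ ωb))) ≠ 0 := by
    rw [Ne, ENNReal.ofReal_eq_zero, not_le]; exact Real.exp_pos _
  have hp := measurable_gibbsDensity hS
  have hmp := fun ω => (gibbsDensity_bounds hωa hωb ω).1
  have hpM := fun ω => (gibbsDensity_bounds hωa hωb ω).2
  haveI hMk := isMarkovKernel_latSweep hp hm0 ENNReal.ofReal_ne_top hmp hpM frames links
  haveI hfin : IsFiniteMeasure (wilsonWeight (d := d) (L := L) ρ β) := by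
    rw [wilsonWeight_eq_pi_withDensity]
    exact isFiniteMeasure_pi_withDensity
      (μ := fun _ : Edge d L => haarProbability (Matrix.specialUnitaryGroup n ℂ))
      ENNReal.ofReal_ne_top hpM
  have h0 : wilsonWeight (d := d) (L := L) ρ β univ ≠ 0 := by
    rw [wilsonWeight_eq_pi_withDensity]
    exact pi_withDensity_univ_ne_zero hm0 hmp
  haveI := isProbabilityMeasure_fwdPathLaw _ h0 κF
  refine ⟨hMk, inferInstance, ?_⟩
  have hK : Kernel.Invariant (latSweep (gibbsDensity fun U : GaugeConfig d L
      (Matrix.specialUnitaryGroup n ℂ) => β * wilsonAction ρ U) frames links)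
      (wilsonWeight (d := d) (L := L) ρ β) := by
    rw [wilsonWeight_eq_pi_withDensity]
    exact latSweep_invariant_withDensity hp hm0 ENNReal.ofReal_ne_top hmp hpM frames links
  obtain ⟨ε, hε, hεmin⟩ := latSweep_minorised hp hm0 ENNReal.ofReal_ne_top hmp hpM frames hlex hl
  have hε1 : ε ≤ 1 := by
    have h1 := Measure.le_iff'.1 (hεmin 1) Set.univ
    rwa [Measure.smul_apply, smul_eq_mul, measure_univ, measure_univ, mul_one] at h1
  haveI : IsFiniteMeasure (ε • Measure.pi (linkHaar (Edge d L) n)) :=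
    Measure.smul_finite _ (ne_top_of_le_ne_top ENNReal.one_ne_top hε1)
  have hmu : (ε • Measure.pi (linkHaar (Edge d L) n)) univ ≠ 0 := by
    rw [Measure.smul_apply, smul_eq_mul, measure_univ, mul_one]
    exact hε
  exact h.tendsto_jarzynskiEstimate_ae_restartChain_of_measure_le _ h0 hK hΔF hmu hεmin

end CM

end Summit.Ventures.LatticeQCDFlow.Exactness.GeneralNCMC
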